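import Mathlib
import HarnessLib
import Summits.NavierStokesRegularity.NavierStokesRegularity.Theorems.TypeILiouvilleShorelineAnalytic
import Literature.Analysis.FluidPDE.OseenZoomCovariance

/-!
# TypeILiouvilleShorelineContinuation — crux (L) stmt-NavierStokesRegularity-10661 `TypeIliouvilleL`:
# UNIQUE CONTINUATION IN PRINT'S CLASS — a bounded ancient mild flow is determined by ONE OPEN PATCH OF ONE SLICE

Helper for stmt-NavierStokesRegularity-10661 (`--supports`); theorems only, no definitions, no named-fact hypotheses;
route-independent imports; closes no item; Navier–Stokes regularity is NOT proved here (leafhand seat of the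
EulerZoomLiouville route; sequel to `TypeILiouvilleShorelineAnalytic`, whose one-slice CONSTANCY rigidity is the case
`v ≡ b` of the theorems below).

Class P = print's class of bounded ancient mild solutions: `v : ℝ → ℝ³ → ℝ³` continuous and bounded on `(−∞,0) × ℝ³`
with `v(t) = e^{(t−s)Δ}v(s) − B¹_s(v,v)(t)` for `s < t < 0` (weak divergence-freeness is not needed here).

* `classP_eq_after_of_slice_eq` — FORWARD UNIQUENESS: two class-P flows with the same slice at `t₀` coincide on
  `(t₀, 0) × ℝ³` (`oseenMild_bounded_unique`).
* `classP_eq_of_slice_locallyEq` — **ONE-PATCH DETERMINATION**: two class-P flows that agree on ONE nonempty open set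
  of ONE slice `t₀ < 0` are identical on `(−∞,0) × ℝ³` (identity theorem on the analytic slice; forward uniqueness;
  backward by analyticity of trajectories).
* `classP_eq_of_spacetime_locallyEq` — space–time unique continuation: agreement on a nonempty open subset of the
  slab forces agreement on the slab (joint analyticity, the slab is preconnected).
* `classP_symmetric_of_locally_symmetric` — a class-P flow that coincides with a Euclidean twin
  `x ↦ R (v t₀ (R⁻¹ x))` (`R` a linear isometry) on one open patch of one slice is `R`-symmetric at all times — the
  entry lemma for symmetric-sector sieves on the (L) residual.

READING for the (L) residual: a counterexample to (L) has NO local freedom — every open space–time patch, indeed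
every open patch of a single slice, determines it; symmetry, periodicity or agreement with a model flow can be
certified locally. [cite: LemarieRieusset2016, Thm. 9.12 (PDF p. 260); KochNadirashviliSereginSverak2009, §4 (arXiv:0709.3599)]
-/

noncomputable section
open MeasureTheory Filter Set Function Metric
open scoped Topology ENNReal
open Literature.Analysis Literature.Analysis.FluidPDE Literature.Analysis.UnboundedOperators
set_option linter.dupNamespace false
namespace Summit.NavierStokesRegularity.NavierStokesRegularity.Theorems.TypeILiouvilleShoreline

/-- **FORWARD UNIQUENESS in print's class.**  Two class-P flows with the same slice at `t₀` coincide on every later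
negative slice (uniqueness of bounded Oseen-mild solutions, `oseenMild_bounded_unique`, plus continuity of the
slices). [cite: KochNadirashviliSereginSverak2009, §4 (arXiv:0709.3599)] -/
theorem classP_eq_after_of_slice_eq
    {u v : ℝ → EuclideanSpace ℝ (Fin 3) → EuclideanSpace ℝ (Fin 3)}
    (huc : ContinuousOn (uncurry u) (Iio 0 ×ˢ univ))
    (huK : ∃ K : ℝ, ∀ t < 0, ∀ x, ‖u t x‖ ≤ K)
    (hum : ∀ s t : ℝ, s < t → t < 0 → ∀ x,
      u t x = heatExtension (u s) (t - s) x - oseenDuhamel 1 s u u t x)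
    (hvc : ContinuousOn (uncurry v) (Iio 0 ×ˢ univ))
    (hvK : ∃ K : ℝ, ∀ t < 0, ∀ x, ‖v t x‖ ≤ K)
    (hvm : ∀ s t : ℝ, s < t → t < 0 → ∀ x,
      v t x = heatExtension (v s) (t - s) x - oseenDuhamel 1 s v v t x)
    {t₀ : ℝ} (h : ∀ x, u t₀ x = v t₀ x) :
    ∀ t ∈ Ioo t₀ 0, ∀ x, u t x = v t x := by
  obtain ⟨Ku, hKu⟩ := huK
  obtain ⟨Kv, hKv⟩ := hvK
  set M : ℝ := max (max Ku Kv) 0 with hM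
  have hM0 : 0 ≤ M := le_max_right _ _
  have hsub : Ioo t₀ 0 ×ˢ (univ : Set (EuclideanSpace ℝ (Fin 3))) ⊆ Iio 0 ×ˢ univ :=
    prod_mono Ioo_subset_Iio_self Subset.rfl
  have humeas : AEStronglyMeasurable (uncurry u) (volume.restrict (Ioo t₀ 0 ×ˢ univ)) :=
    (huc.mono hsub).aestronglyMeasurable (measurableSet_Ioo.prod MeasurableSet.univ)
  have hvmeas : AEStronglyMeasurable (uncurry v) (volume.restrict (Ioo t₀ 0 ×ˢ univ)) :=
    (hvc.mono hsub).aestronglyMeasurable (measurableSet_Ioo.prod MeasurableSet.univ)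
  have huM : ∀ τ ∈ Ioo t₀ 0, ∀ y, ‖u τ y‖ ≤ M := fun τ hτ y =>
    (hKu τ hτ.2 y).trans ((le_max_left _ _).trans (le_max_left _ _))
  have hvM : ∀ τ ∈ Ioo t₀ 0, ∀ y, ‖v τ y‖ ≤ M := fun τ hτ y =>
    (hKv τ hτ.2 y).trans ((le_max_right _ _).trans (le_max_left _ _))
  have hu : ∀ τ ∈ Ioo t₀ 0, u τ =ᵐ[volume] fun y =>
      heatExtension (u t₀) (1 * (τ - t₀)) y - oseenDuhamel 1 t₀ u u τ y :=
    fun τ hτ => Eventually.of_forall fun y => by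
      rw [one_mul]
      exact hum t₀ τ hτ.1 hτ.2 y
  have hslice : v t₀ = u t₀ := funext fun x => (h x).symm
  have hv : ∀ τ ∈ Ioo t₀ 0, v τ =ᵐ[volume] fun y =>
      heatExtension (u t₀) (1 * (τ - t₀)) y - oseenDuhamel 1 t₀ v v τ y :=
    fun τ hτ => Eventually.of_forall fun y => by
      rw [one_mul, ← hslice]
      exact hvm t₀ τ hτ.1 hτ.2 y
  have key := oseenMild_bounded_unique
    (U := fun τ y => heatExtension (u t₀) (1 * (τ - t₀)) y) one_pos hM0 humeas hvmeas huM hvM hu hv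
  intro t ht x
  have hcu : Continuous (u t) :=
    huc.comp_continuous (Continuous.prodMk_right t) fun y => mem_prod.2 ⟨ht.2, mem_univ y⟩
  have hcv : Continuous (v t) :=
    hvc.comp_continuous (Continuous.prodMk_right t) fun y => mem_prod.2 ⟨ht.2, mem_univ y⟩
  exact congrFun ((Continuous.ae_eq_iff_eq volume hcu hcv).1 (key t ht)) x

/-- **ONE-PATCH DETERMINATION.**  Two class-P flows which agree on ONE nonempty open set of ONE slice `t₀ < 0` are
identical on all of `(−∞,0) × ℝ³`: the analytic slices agree everywhere (identity theorem), later slices by forward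
uniqueness, earlier slices by analyticity of the trajectories `t ↦ u t x`, `t ↦ v t x` on the preconnected `(−∞,0)`.
[cite: LemarieRieusset2016, Thm. 9.12 (PDF p. 260)] -/
theorem classP_eq_of_slice_locallyEq
    {u v : ℝ → EuclideanSpace ℝ (Fin 3) → EuclideanSpace ℝ (Fin 3)}
    (huc : ContinuousOn (uncurry u) (Iio 0 ×ˢ univ))
    (huK : ∃ K : ℝ, ∀ t < 0, ∀ x, ‖u t x‖ ≤ K)
    (hum : ∀ s t : ℝ, s < t → t < 0 → ∀ x,
      u t x = heatExtension (u s) (t - s) x - oseenDuhamel 1 s u u t x)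
    (hvc : ContinuousOn (uncurry v) (Iio 0 ×ˢ univ))
    (hvK : ∃ K : ℝ, ∀ t < 0, ∀ x, ‖v t x‖ ≤ K)
    (hvm : ∀ s t : ℝ, s < t → t < 0 → ∀ x,
      v t x = heatExtension (v s) (t - s) x - oseenDuhamel 1 s v v t x)
    {t₀ : ℝ} (ht₀ : t₀ < 0) {U : Set (EuclideanSpace ℝ (Fin 3))} (hUo : IsOpen U) (hUne : U.Nonempty)
    (h : ∀ x ∈ U, u t₀ x = v t₀ x) :
    ∀ t < 0, ∀ x, u t x = v t x := by
  obtain ⟨z₀, hz₀⟩ := hUne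
  -- the slices at `t₀` agree everywhere
  have hslice : ∀ x, u t₀ x = v t₀ x := by
    have hev : u t₀ =ᶠ[𝓝 z₀] v t₀ := by
      filter_upwards [hUo.mem_nhds hz₀] with y hy using h y hy
    have heq := (classP_analyticOnNhd_slice huc huK hum ht₀).eqOn_of_preconnected_of_eventuallyEq
      (classP_analyticOnNhd_slice hvc hvK hvm ht₀)
      (convex_univ (𝕜 := ℝ) (E := EuclideanSpace ℝ (Fin 3))).isPreconnected (mem_univ z₀) hev
    exact fun x => heq (mem_univ x)
  have hfwd := classP_eq_after_of_slice_eq huc huK hum hvc hvK hvm hslice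
  intro t ht x
  have hz : t₀ / 2 ∈ Ioo t₀ 0 := ⟨by linarith, by linarith⟩
  have hev : (fun τ => u τ x) =ᶠ[𝓝 (t₀ / 2)] fun τ => v τ x := by
    filter_upwards [isOpen_Ioo.mem_nhds hz] with τ hτ using hfwd τ hτ x
  exact (classP_analyticOnNhd_time huc huK hum x).eqOn_of_preconnected_of_eventuallyEq
    (classP_analyticOnNhd_time hvc hvK hvm x) (convex_Iio (0 : ℝ)).isPreconnected (mem_Iio.2 hz.2) hev
    (mem_Iio.2 ht)

/-- **SPACE–TIME UNIQUE CONTINUATION.**  Two class-P flows which agree on a nonempty open subset of the slab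
`(−∞,0) × ℝ³` agree on the whole slab (joint analyticity; the slab is convex, hence preconnected).
[cite: LemarieRieusset2016, Thm. 9.12 (PDF p. 260)] -/
theorem classP_eq_of_spacetime_locallyEq
    {u v : ℝ → EuclideanSpace ℝ (Fin 3) → EuclideanSpace ℝ (Fin 3)}
    (huc : ContinuousOn (uncurry u) (Iio 0 ×ˢ univ))
    (huK : ∃ K : ℝ, ∀ t < 0, ∀ x, ‖u t x‖ ≤ K)
    (hum : ∀ s t : ℝ, s < t → t < 0 → ∀ x,
      u t x = heatExtension (u s) (t - s) x - oseenDuhamel 1 s u u t x)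
    (hvc : ContinuousOn (uncurry v) (Iio 0 ×ˢ univ))
    (hvK : ∃ K : ℝ, ∀ t < 0, ∀ x, ‖v t x‖ ≤ K)
    (hvm : ∀ s t : ℝ, s < t → t < 0 → ∀ x,
      v t x = heatExtension (v s) (t - s) x - oseenDuhamel 1 s v v t x)
    {W : Set (ℝ × EuclideanSpace ℝ (Fin 3))} (hWo : IsOpen W) (hWne : W.Nonempty)
    (hWsub : W ⊆ Iio 0 ×ˢ univ) (h : ∀ p ∈ W, uncurry u p = uncurry v p) :
    ∀ t < 0, ∀ x, u t x = v t x := by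
  obtain ⟨p₀, hp₀⟩ := hWne
  have hev : uncurry u =ᶠ[𝓝 p₀] uncurry v := by
    filter_upwards [hWo.mem_nhds hp₀] with p hp using h p hp
  have hpre : IsPreconnected (Iio (0 : ℝ) ×ˢ (univ : Set (EuclideanSpace ℝ (Fin 3)))) :=
    ((convex_Iio (0 : ℝ)).prod convex_univ).isPreconnected
  have heq := (classP_analyticOnNhd_uncurry huc huK hum).eqOn_of_preconnected_of_eventuallyEq
    (classP_analyticOnNhd_uncurry hvc hvK hvm) hpre (hWsub hp₀) hev
  intro t ht x
  exact heq (show ((t, x) : ℝ × EuclideanSpace ℝ (Fin 3)) ∈ Iio (0 : ℝ) ×ˢ (univ : Set (EuclideanSpace ℝ (Fin 3)))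
    from mem_prod.2 ⟨mem_Iio.2 ht, mem_univ x⟩)

/-- The Euclidean twin `(t, x) ↦ R (v t (R⁻¹ x))` of a class-P flow under a linear isometry `R` is again in class P
(continuity, the same bound, and the Oseen identity transported by the tree's `heatExtension_conj_linearIsometryEquiv`
and `oseenDuhamel_symm_conj_linearIsometryEquiv`, `Literature.Analysis.FluidPDE.OseenZoomCovariance`).
[cite: KochNadirashviliSereginSverak2009, §4 (arXiv:0709.3599)] -/
theorem classP_conj_linearIsometryEquiv
    {v : ℝ → EuclideanSpace ℝ (Fin 3) → EuclideanSpace ℝ (Fin 3)}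
    (hvc : ContinuousOn (uncurry v) (Iio 0 ×ˢ univ))
    (hvK : ∃ K : ℝ, ∀ t < 0, ∀ x, ‖v t x‖ ≤ K)
    (hvm : ∀ s t : ℝ, s < t → t < 0 → ∀ x,
      v t x = heatExtension (v s) (t - s) x - oseenDuhamel 1 s v v t x)
    (R : EuclideanSpace ℝ (Fin 3) ≃ₗᵢ[ℝ] EuclideanSpace ℝ (Fin 3)) :
    ContinuousOn (uncurry fun t x => R (v t (R.symm x))) (Iio 0 ×ˢ univ) ∧
    (∃ K : ℝ, ∀ t < 0, ∀ x, ‖R (v t (R.symm x))‖ ≤ K) ∧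
    (∀ s t : ℝ, s < t → t < 0 → ∀ x,
      R (v t (R.symm x)) = heatExtension (fun y => R (v s (R.symm y))) (t - s) x -
        oseenDuhamel 1 s (fun τ y => R (v τ (R.symm y))) (fun τ y => R (v τ (R.symm y))) t x) := by
  refine ⟨?_, ?_, fun s t hst ht x => ?_⟩
  · have hmap : ContinuousOn (fun p : ℝ × EuclideanSpace ℝ (Fin 3) => (p.1, R.symm p.2)) (Iio 0 ×ˢ univ) := by
      fun_prop
    have hmaps : MapsTo (fun p : ℝ × EuclideanSpace ℝ (Fin 3) => (p.1, R.symm p.2)) (Iio 0 ×ˢ univ)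
        (Iio 0 ×ˢ univ) := fun p hp => ⟨(mem_prod.1 hp).1, mem_univ _⟩
    exact (R.continuous.comp_continuousOn (hvc.comp hmap hmaps)).congr fun p _ => rfl
  · obtain ⟨K, hK⟩ := hvK
    exact ⟨K, fun t ht x => by rw [LinearIsometryEquiv.norm_map]; exact hK t ht _⟩
  · have hD := oseenDuhamel_symm_conj_linearIsometryEquiv R.symm 1 s v v t x
    simp only [LinearIsometryEquiv.symm_symm] at hD
    rw [hvm s t hst ht (R.symm x), map_sub, heatExtension_conj_linearIsometryEquiv, hD]

/-- **LOCAL SYMMETRY IS GLOBAL SYMMETRY.**  If a class-P flow coincides with its Euclidean twin under a linear isometry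
`R` — `v t₀ x = R (v t₀ (R⁻¹ x))` — on ONE nonempty open set of ONE slice `t₀ < 0`, then it is `R`-symmetric on all of
`(−∞,0) × ℝ³`.  (One-patch determination applied to `v` and its twin, which is again in class P.)  Entry lemma for
symmetric-sector sieves on the (L) residual. [cite: LemarieRieusset2016, Thm. 9.12 (PDF p. 260)] -/
theorem classP_symmetric_of_locally_symmetric
    {v : ℝ → EuclideanSpace ℝ (Fin 3) → EuclideanSpace ℝ (Fin 3)}
    (hvc : ContinuousOn (uncurry v) (Iio 0 ×ˢ univ))
    (hvK : ∃ K : ℝ, ∀ t < 0, ∀ x, ‖v t x‖ ≤ K)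
    (hvm : ∀ s t : ℝ, s < t → t < 0 → ∀ x,
      v t x = heatExtension (v s) (t - s) x - oseenDuhamel 1 s v v t x)
    (R : EuclideanSpace ℝ (Fin 3) ≃ₗᵢ[ℝ] EuclideanSpace ℝ (Fin 3))
    {t₀ : ℝ} (ht₀ : t₀ < 0) {U : Set (EuclideanSpace ℝ (Fin 3))} (hUo : IsOpen U) (hUne : U.Nonempty)
    (h : ∀ x ∈ U, v t₀ x = R (v t₀ (R.symm x))) :
    ∀ t < 0, ∀ x, v t x = R (v t (R.symm x)) := by
  obtain ⟨hwc, hwK, hwm⟩ := classP_conj_linearIsometryEquiv hvc hvK hvm R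
  exact classP_eq_of_slice_locallyEq hvc hvK hvm hwc hwK hwm ht₀ hUo hUne h

end Summit.NavierStokesRegularity.NavierStokesRegularity.Theorems.TypeILiouvilleShoreline

end
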